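import Mathlib
import HarnessLib
import Literature.AlgebraicGeometry.HodgeTheory.ChernCharacterBetti
import Literature.AlgebraicGeometry.Modules.VectorBundleFiniteLocallyFree
import Literature.AlgebraicGeometry.Modules.KernelFiniteLocallyFree

/-!
# C-evaluability of elementary transformations: `ch(ker(V ↠ Q)) = ch V + ch K − ch M` for ANY bundle
# presentation `0 → K → M → Q → 0` of the quotient (route `KleimanBFSeeds`, crux K2ᵀ 28148, rider (o3))

HONEST FRAMING: HELPER lemmas `--supports stmt-HodgeConjecture-28148` (crux `TwistNormalisedKleimanSemiregularAnchor`,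
registered rung `stub_rung_CMclass_d3 : KleimanAnchorRungCM 3` of
`Cruxes/TwistNormalisedKleimanSemiregularAnchor/Lines/chosen_anchor.lean`). Nothing here constructs a sheaf, computes an
`Ext` group or proves the rung, K2ᵀ, `WeilSixfolds`, HC_AV, HC_CM or HC.

WHAT IT ANSWERS. The rung quantifies over every Chern character theory `C : ChernCharacterBetti`; rider (o3) of the
director's brief asks, for a WRITTEN object `E`, which fields of `C` pin `chᵢ(E)`. The tree's additivity field
`ChernCharacterBetti.ch_shortExact` speaks only of short exact sequences whose OUTER terms are vector bundles, so it is
silent on the live design family of the crux (hodge-idea-1's divisorial elementary transformations ∕ D7 towers ∕ the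
«N′ = 8» design `E = ker(𝒪^{⊕r₀} ⊕ ⊕_ζ 𝒪(2D_ζ) ↠ T)`, evidence #28–#31 on 28148): there `E = ker(V ↠ Q)` with `Q` a
TORSION sheaf (pieces `i_*M` on 5-dimensional sub-tori), and `0 → E → V → Q → 0` has no vector bundle on the right.
This file proves that `C` nevertheless pins `ch(E)` as soon as `Q` has ONE two-term presentation by vector bundles
`0 → K → M → Q → 0` (for `Q = i_*(M̃|_D)`, `D` a Cartier divisor and `M̃` a bundle on the ambient variety:
`0 → M̃(−D) → M̃ → i_*(M̃|_D) → 0`):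

  `chᵢ(E) = chᵢ(V) + chᵢ(K) − chᵢ(M)`   (`ch_kernel_eq_of_presentation`, every `C`, every `i`, every scheme).

PROOF (the pullback trick, abelian-category level, §1): `E′ := V ×_Q M` sits in TWO short exact sequences with
vector-bundle outer terms, `0 → K → E′ → V → 0` and `0 → E → E′ → M → 0` (`shortExact_kernel_pullback`,
applied to `(p, r)` and to `(r, p)`, the two fibre products being identified by `pullbackSymmetry`); apply
`ch_shortExact` to both and subtract. No lifting of `V → Q` through `M → Q` is needed, and the middle term `E′` is never
asked to be locally free (it is: `isVectorBundle_kernelPullback`).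

CONSEQUENCES (§2–§4; §4: cokernel-presented pieces `shortExact_of_mono_cokernel` ∕ `ch_kernel_eq_of_cokernel_presentation`, and LOCAL FREENESS of the transform `isVectorBundle_kernel_of_presentation` — hodge-idea-1 (L1) without homological dimension; plus `shortExact_biprod_map` ∕ `ch_kernel_eq_of_presentation_biprod` for direct sums of presented pieces): independence of the presentation (`ch_sub_eq_of_two_presentations`: `ch K − ch M` depends on `Q`
only); two-step towers (`ch_kernel_tower_eq`); closure under a submodule of classes (`ch_kernel_mem_of_presentation_mem`:
if `ch V, ch K, ch M` lie in a `ℂ`-submodule `L` — e.g. the design line `ℚ[h] ⊕ ℚ·w ⊗ ℂ` — so does `ch E`). Together with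
the twist certificate p814714 (`exists_twistScalar_ch_serreTwist`: Serre twists along maps to one `ℙᴺ` have `C`-character
pinned up to one scalar `k(C)`) this makes every object assembled from Serre twists by direct sums, kernels of bundle
surjections, extensions AND elementary transformations along divisors with bundle-presented pieces `C`-evaluable,
uniformly in the twist-normalised `C` — the (o3) column for the D7 ∕ «N′ = 8» family. `KleimanChernNormalForm` and
`IsTwistNormalised` are not used: the identities hold for every `C`.

References: [Fulton1998] §15.1 (additivity on exact sequences; Example 15.1.1), Example 3.2.3, Example 15.3.1
(`ch` of `𝒪_D` via `0 → 𝒪(−D) → 𝒪 → 𝒪_D → 0`); [Hartshorne1977] II Prop. 6.18 and Ex. 5.7; [Maruyama1982ElementaryTransformations] M. Maruyama,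
*Elementary transformations in the theory of algebraic vector bundles*, LNM 961 (1982) (the construction `ker(V ↠ i_*F)`);
[StacksProject] Tag 05P2 (kernel of an epimorphism of finite locally free modules), Tag 08N4 (pullbacks in abelian
categories).
-/

-- every declaration of this problem lives in `Summit.HodgeConjecture.HodgeConjecture.…` (summit = sub-problem)
set_option linter.dupNamespace false

noncomputable section

open CategoryTheory CategoryTheory.Limits

namespace Summit.HodgeConjecture.HodgeConjecture.Theorems

/-! ### §1 The pullback trick in an abelian category -/

section Abelian

universe v u

variable {𝒜 : Type u} [Category.{v} 𝒜] [Abelian 𝒜]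

/-- **The pullback of a short exact sequence is short exact** (Stacks 08N4; the «pullback trick»): if
`0 → K → M → Q → 0` (`T`) is short exact and `f : X ⟶ Q` is any morphism, then the kernel–pullback complex
`0 → K ⟶ X ×_Q M ⟶ X → 0` — first map `(0, T.f)` into the fibre product `pullback f T.g`, second map the first
projection — is short exact: the first projection is an epimorphism (pull-back of the epimorphism `M ↠ Q`, an abelian
category being regular) and its kernel is `K` (a map into `X ×_Q M` with zero first component is a map into `M` killed
by `M → Q`). [cite: StacksProject, Tag 08N4] -/
theorem shortExact_kernel_pullback {T : ShortComplex 𝒜} (hT : T.ShortExact) {X : 𝒜} (f : X ⟶ T.X₃) :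
    (ShortComplex.mk (pullback.lift (0 : T.X₁ ⟶ X) T.f (by rw [zero_comp, T.zero]) : T.X₁ ⟶ pullback f T.g)
      (pullback.fst f T.g) (pullback.lift_fst _ _ _)).ShortExact := by
  haveI : Mono T.f := hT.mono_f
  haveI : Epi T.g := hT.epi_g
  have hsnd : pullback.lift (0 : T.X₁ ⟶ X) T.f (by rw [zero_comp, T.zero]) ≫ pullback.snd f T.g = T.f :=
    pullback.lift_snd _ _ _
  have hfst : pullback.lift (0 : T.X₁ ⟶ X) T.f (by rw [zero_comp, T.zero]) ≫ pullback.fst f T.g = 0 :=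
    pullback.lift_fst _ _ _
  haveI hmono : Mono (pullback.lift (0 : T.X₁ ⟶ X) T.f (by rw [zero_comp, T.zero]) : T.X₁ ⟶ pullback f T.g) :=
    mono_of_mono_fac hsnd
  refine ShortComplex.ShortExact.mk' ?_ hmono (inferInstanceAs (Epi (pullback.fst f T.g)))
  refine ShortComplex.exact_of_f_is_kernel _ (KernelFork.IsLimit.ofι' _ _ (fun {A} k hk => ?_))
  -- `k : A ⟶ X ×_Q M` with `k ≫ fst = 0`: its second component is killed by `T.g`, so it lifts to `K`
  have hk' : k ≫ pullback.fst f T.g = 0 := hk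
  have hk2 : (k ≫ pullback.snd f T.g) ≫ T.g = 0 := by
    rw [Category.assoc, ← pullback.condition, ← Category.assoc, hk', zero_comp]
  refine ⟨hT.exact.lift (k ≫ pullback.snd f T.g) hk2, ?_⟩
  change hT.exact.lift (k ≫ pullback.snd f T.g) hk2 ≫ pullback.lift (0 : T.X₁ ⟶ X) T.f _ = k
  apply pullback.hom_ext
  · rw [Category.assoc, hfst, comp_zero, hk']
  · rw [Category.assoc, hsnd, hT.exact.lift_f]

/-- **Direct sums of presentations.** If `0 → K₁ → M₁ → Q₁ → 0` and `0 → K₂ → M₂ → Q₂ → 0` are short exact, so is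
`0 → K₁ ⊞ K₂ → M₁ ⊞ M₂ → Q₁ ⊞ Q₂ → 0` (componentwise maps `biprod.map`): bundle presentations of the pieces of a
direct sum `Q = Q₁ ⊞ Q₂` assemble to a bundle presentation of `Q` (the torsion quotient of the «N′ = 8» design is a direct
sum of fifteen pieces). [folklore] -/
theorem shortExact_biprod_map {T₁ T₂ : ShortComplex 𝒜} (h₁ : T₁.ShortExact) (h₂ : T₂.ShortExact) :
    (ShortComplex.mk (biprod.map T₁.f T₂.f) (biprod.map T₁.g T₂.g)
      (by ext <;> simp) :
        ShortComplex 𝒜).ShortExact := by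
  haveI : Mono T₁.f := h₁.mono_f
  haveI : Mono T₂.f := h₂.mono_f
  haveI : Epi T₁.g := h₁.epi_g
  haveI : Epi T₂.g := h₂.epi_g
  refine ShortComplex.ShortExact.mk' ?_ (inferInstanceAs (Mono (biprod.map T₁.f T₂.f)))
    (inferInstanceAs (Epi (biprod.map T₁.g T₂.g)))
  refine ShortComplex.exact_of_f_is_kernel _ (KernelFork.IsLimit.ofι' _ _ (fun {A} k hk => ?_))
  have hk' : k ≫ biprod.map T₁.g T₂.g = 0 := hk
  have hk₁ : (k ≫ biprod.fst) ≫ T₁.g = 0 := by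
    rw [Category.assoc, ← biprod.map_fst, ← Category.assoc, hk', zero_comp]
  have hk₂ : (k ≫ biprod.snd) ≫ T₂.g = 0 := by
    rw [Category.assoc, ← biprod.map_snd, ← Category.assoc, hk', zero_comp]
  refine ⟨biprod.lift (h₁.exact.lift _ hk₁) (h₂.exact.lift _ hk₂), ?_⟩
  apply biprod.hom_ext
  · change (biprod.lift _ _ ≫ biprod.map T₁.f T₂.f) ≫ biprod.fst = k ≫ biprod.fst
    rw [Category.assoc, biprod.map_fst, biprod.lift_fst_assoc, h₁.exact.lift_f]
  · change (biprod.lift _ _ ≫ biprod.map T₁.f T₂.f) ≫ biprod.snd = k ≫ biprod.snd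
    rw [Category.assoc, biprod.map_snd, biprod.lift_snd_assoc, h₂.exact.lift_f]

end Abelian

/-! ### §2 The Chern character of the kernel of a surjection onto a bundle-presented quotient -/

section Chern

open AlgebraicGeometry ZeroObject
open Literature.AlgebraicGeometry Literature.AlgebraicGeometry.Motives Literature.AlgebraicGeometry.HodgeTheory

variable (C : ChernCharacterBetti) {X : SchemeOver ℂ}

/-- **`ch` of a fibre product over a bundle-presented quotient**: if `0 → K → M → Q → 0` is short exact with `K` a
vector bundle and `f : V ⟶ Q` has `V` a vector bundle, then `chᵢ(V ×_Q M) = chᵢ(K) + chᵢ(V)` (additivity on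
`0 → K → V ×_Q M → V → 0`; the middle term need not be known to be locally free for the field `ch_shortExact`).
[cite: Fulton1998, §15.1 and Example 3.2.3] -/
theorem ch_kernelPullback_eq_add {T : ShortComplex X.left.Modules} (hT : T.ShortExact) {V : X.left.Modules}
    (f : V ⟶ T.X₃) (hK : IsVectorBundle T.X₁) (hV : IsVectorBundle V) (i : ℕ) :
    C.ch X (pullback f T.g) i = C.ch X T.X₁ i + C.ch X V i :=
  C.ch_shortExact _ (shortExact_kernel_pullback hT f) hK hV i

/-- **C-evaluability of elementary transformations (main lemma).** Let `0 → K → M → Q → 0` (`T`) be short exact with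
`K`, `M` vector bundles — a two-term bundle presentation of an ARBITRARY `𝒪_X`-module `Q` (e.g. `Q = i_*(M̃|_D)`
presented by `0 → M̃(−D) → M̃ → Q → 0`) — and let `0 → E → V → Q → 0` be short exact with `E`, `V` vector bundles
(`E = ker(V ↠ Q)`, an elementary transformation of `V` along `Q`). Then for EVERY Chern character theory `C` and every
`i`, `chᵢ(E) = chᵢ(V) + chᵢ(K) − chᵢ(M)`. Proof: both `0 → K → V ×_Q M → V → 0` and `0 → E → M ×_Q V → M → 0` are
short exact with bundle ends, and `V ×_Q M ≅ M ×_Q V`. [cite: Fulton1998, §15.1, Example 15.1.1 and Example 15.3.1] -/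
theorem ch_kernel_eq_of_presentation {T : ShortComplex X.left.Modules} (hT : T.ShortExact)
    (hK : IsVectorBundle T.X₁) (hM : IsVectorBundle T.X₂) {E V : X.left.Modules} (j : E ⟶ V) (p : V ⟶ T.X₃)
    (w : j ≫ p = 0) (hE : (ShortComplex.mk j p w).ShortExact) (hEvb : IsVectorBundle E) (hV : IsVectorBundle V)
    (i : ℕ) :
    C.ch X E i = C.ch X V i + C.ch X T.X₁ i - C.ch X T.X₂ i := by
  -- `ch(V ×_Q M) = ch K + ch V`
  have h₁ := ch_kernelPullback_eq_add C hT p hK hV i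
  -- `ch(M ×_Q V) = ch E + ch M` (the same lemma for the presentation `0 → E → V → Q → 0` and the map `T.g : M → Q`)
  have h₂ := ch_kernelPullback_eq_add C hE T.g hEvb hM i
  -- `V ×_Q M ≅ M ×_Q V`
  have h₃ : C.ch X (pullback p T.g) i = C.ch X (pullback T.g p) i := C.ch_congr (pullbackSymmetry p T.g) i
  change C.ch X (pullback T.g p) i = C.ch X E i + C.ch X T.X₂ i at h₂
  rw [h₃, h₂] at h₁
  -- `ch E + ch M = ch K + ch V`
  rw [eq_sub_iff_add_eq, h₁, add_comm]

/-- **Independence of the presentation**: two bundle presentations `0 → K → M → Q → 0` and `0 → K′ → M′ → Q → 0` of the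
same `Q` have `chᵢ(K′) − chᵢ(M′) = chᵢ(K) − chᵢ(M)` — the virtual character `ch(Q) := ch M − ch K` read through `C` is
well defined (the main lemma with `E := K′`, `V := M′`). [cite: Fulton1998, §15.1 (B) and Example 15.1.1] -/
theorem ch_sub_eq_of_two_presentations {T : ShortComplex X.left.Modules} (hT : T.ShortExact)
    (hK : IsVectorBundle T.X₁) (hM : IsVectorBundle T.X₂) {K' M' : X.left.Modules} (j : K' ⟶ M') (r' : M' ⟶ T.X₃)
    (w : j ≫ r' = 0) (hT' : (ShortComplex.mk j r' w).ShortExact) (hK' : IsVectorBundle K')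
    (hM' : IsVectorBundle M') (i : ℕ) :
    C.ch X K' i - C.ch X M' i = C.ch X T.X₁ i - C.ch X T.X₂ i := by
  rw [ch_kernel_eq_of_presentation C hT hK hM j r' w hT' hK' hM' i]
  abel

/-- **Closure under a submodule of classes** (the design-line form): if `chᵢ(V)`, `chᵢ(K)`, `chᵢ(M)` lie in a
`ℂ`-submodule `L` of `H²ⁱ(X(ℂ); ℂ)` (e.g. the complexified design line `ℚ·hⁱ ⊕ ℚ·w`), then so does `chᵢ(E)` for the
elementary transformation `E = ker(V ↠ Q)`. [cite: Fulton1998, §15.1 and Example 15.3.1] -/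
theorem ch_kernel_mem_of_presentation_mem {T : ShortComplex X.left.Modules} (hT : T.ShortExact)
    (hK : IsVectorBundle T.X₁) (hM : IsVectorBundle T.X₂) {E V : X.left.Modules} (j : E ⟶ V) (p : V ⟶ T.X₃)
    (w : j ≫ p = 0) (hE : (ShortComplex.mk j p w).ShortExact) (hEvb : IsVectorBundle E) (hV : IsVectorBundle V)
    (i : ℕ) (L : Submodule ℂ (complexBetti X (2 * i))) (hVL : C.ch X V i ∈ L) (hKL : C.ch X T.X₁ i ∈ L)
    (hML : C.ch X T.X₂ i ∈ L) :
    C.ch X E i ∈ L := by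
  rw [ch_kernel_eq_of_presentation C hT hK hM j p w hE hEvb hV i]
  exact L.sub_mem (L.add_mem hVL hKL) hML

/-- **Two-step towers** (hodge-idea-1's D7 shape `E₂ ⊂ E₁ ⊂ V`): if `E₁ = ker(V ↠ Q₁)` and `E₂ = ker(E₁ ↠ Q₂)` with
bundle presentations `0 → K₁ → M₁ → Q₁ → 0`, `0 → K₂ → M₂ → Q₂ → 0` and `V`, `E₁`, `E₂` vector bundles, then
`chᵢ(E₂) = chᵢ(V) + (chᵢ(K₁) − chᵢ(M₁)) + (chᵢ(K₂) − chᵢ(M₂))`. [cite: Fulton1998, §15.1 and Example 15.3.1] -/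
theorem ch_kernel_tower_eq {T₁ T₂ : ShortComplex X.left.Modules} (hT₁ : T₁.ShortExact) (hT₂ : T₂.ShortExact)
    (hK₁ : IsVectorBundle T₁.X₁) (hM₁ : IsVectorBundle T₁.X₂) (hK₂ : IsVectorBundle T₂.X₁)
    (hM₂ : IsVectorBundle T₂.X₂) {E₂ E₁ V : X.left.Modules} (j₁ : E₁ ⟶ V) (p₁ : V ⟶ T₁.X₃) (w₁ : j₁ ≫ p₁ = 0)
    (hE₁ : (ShortComplex.mk j₁ p₁ w₁).ShortExact) (j₂ : E₂ ⟶ E₁) (p₂ : E₁ ⟶ T₂.X₃) (w₂ : j₂ ≫ p₂ = 0)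
    (hE₂ : (ShortComplex.mk j₂ p₂ w₂).ShortExact) (hV : IsVectorBundle V) (hE₁vb : IsVectorBundle E₁)
    (hE₂vb : IsVectorBundle E₂) (i : ℕ) :
    C.ch X E₂ i = C.ch X V i + (C.ch X T₁.X₁ i - C.ch X T₁.X₂ i) + (C.ch X T₂.X₁ i - C.ch X T₂.X₂ i) := by
  rw [ch_kernel_eq_of_presentation C hT₂ hK₂ hM₂ j₂ p₂ w₂ hE₂ hE₂vb hE₁vb i,
    ch_kernel_eq_of_presentation C hT₁ hK₁ hM₁ j₁ p₁ w₁ hE₁ hE₁vb hV i]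
  abel

/-! ### §3 The fibre product is a vector bundle; the kernel form -/

/-- The fibre product `V ×_Q M` over a bundle-presented `Q` (`0 → K → M → Q → 0`, `K` a vector bundle) with `V` a vector
bundle is itself a vector bundle (extension of `V` by `K`; Hartshorne II Ex. 5.7 ∕ Stacks 01C6 for extensions, tree
`isFiniteLocallyFree_of_shortExact`). [cite: Hartshorne1977, II Ex. 5.7] -/
theorem isVectorBundle_kernelPullback {T : ShortComplex X.left.Modules} (hT : T.ShortExact) {V : X.left.Modules}
    (f : V ⟶ T.X₃) (hK : IsVectorBundle T.X₁) (hV : IsVectorBundle V) :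
    IsVectorBundle (pullback f T.g) :=
  (isFiniteLocallyFree_of_shortExact (shortExact_kernel_pullback hT f) hK.isFiniteLocallyFree
    hV.isFiniteLocallyFree).isVectorBundle

/-- **Kernel form of the main lemma** (Mathlib's chosen kernel): for an epimorphism `p : V ⟶ Q` onto a bundle-presented
`Q` with `V` and `kernel p` vector bundles, `chᵢ(kernel p) = chᵢ(V) + chᵢ(K) − chᵢ(M)`.
[cite: Fulton1998, §15.1 and Example 15.3.1] -/
theorem ch_kernel_eq_of_presentation' {T : ShortComplex X.left.Modules} (hT : T.ShortExact)
    (hK : IsVectorBundle T.X₁) (hM : IsVectorBundle T.X₂) {V : X.left.Modules} (p : V ⟶ T.X₃) [Epi p]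
    (hEvb : IsVectorBundle (kernel p)) (hV : IsVectorBundle V) (i : ℕ) :
    C.ch X (kernel p) i = C.ch X V i + C.ch X T.X₁ i - C.ch X T.X₂ i :=
  ch_kernel_eq_of_presentation C hT hK hM (kernel.ι p) p (kernel.condition p)
    (ShortComplex.ShortExact.mk' (ShortComplex.exact_of_f_is_kernel _ (kernelIsKernel p)) inferInstance
      inferInstance) hEvb hV i

/-- **Bundle quotients as the degenerate case**: if `Q` is itself a vector bundle, presented by `0 → 0 → Q = Q → 0`, the
main lemma returns the additivity field `chᵢ(E) = chᵢ(V) − chᵢ(Q)` (tree `ch_kernel_eq_sub`, p814714) — consistency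
check of the presentation calculus. [cite: Fulton1998, §15.1] -/
theorem ch_kernel_eq_of_presentation_self {E V Q : X.left.Modules} (j : E ⟶ V) (p : V ⟶ Q) (w : j ≫ p = 0)
    (hE : (ShortComplex.mk j p w).ShortExact) (hEvb : IsVectorBundle E) (hV : IsVectorBundle V)
    (hQ : IsVectorBundle Q) (i : ℕ) :
    C.ch X E i = C.ch X V i - C.ch X Q i := by
  have hT : (ShortComplex.mk (0 : (0 : X.left.Modules) ⟶ Q) (𝟙 Q) zero_comp).ShortExact :=
    ShortComplex.ShortExact.mk' ((ShortComplex.exact_iff_mono _ rfl).2 (inferInstanceAs (Mono (𝟙 Q))))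
      (inferInstanceAs (Mono (0 : (0 : X.left.Modules) ⟶ Q))) (inferInstanceAs (Epi (𝟙 Q)))
  have h0 : IsVectorBundle (0 : X.left.Modules) :=
    (Motives.hasRankLE_zero_of_isZero (isZero_zero _)).isVectorBundle
  rw [ch_kernel_eq_of_presentation C hT h0 hQ j p w hE hEvb hV i, C.ch_eq_zero_of_isZero (isZero_zero _) i,
    add_zero]

/-- Direct sums of vector bundles are vector bundles (extension `0 → E → E ⊞ F → F → 0`, tree
`isFiniteLocallyFree_of_shortExact`). [cite: Hartshorne1977, II Ex. 5.7] -/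
theorem isVectorBundle_biprod_of_isVectorBundle {E F : X.left.Modules} (hE : IsVectorBundle E)
    (hF : IsVectorBundle F) : IsVectorBundle (E ⊞ F) :=
  (isFiniteLocallyFree_of_shortExact (ShortComplex.Splitting.ofHasBinaryBiproduct E F).shortExact
    hE.isFiniteLocallyFree hF.isFiniteLocallyFree).isVectorBundle

/-- **Elementary transformation along a direct sum of two bundle-presented pieces**: if `Q₁`, `Q₂` have bundle
presentations `0 → Kₖ → Mₖ → Qₖ → 0` and `0 → E → V → Q₁ ⊞ Q₂ → 0` is short exact with `E`, `V` vector bundles, then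
`chᵢ(E) = chᵢ(V) + (chᵢ(K₁) − chᵢ(M₁)) + (chᵢ(K₂) − chᵢ(M₂))` (the assembled presentation `shortExact_biprod_map` and
Whitney for `⊞`, field `ch_biprod`). [cite: Fulton1998, §15.1 and Example 3.2.3] -/
theorem ch_kernel_eq_of_presentation_biprod {T₁ T₂ : ShortComplex X.left.Modules} (hT₁ : T₁.ShortExact)
    (hT₂ : T₂.ShortExact) (hK₁ : IsVectorBundle T₁.X₁) (hM₁ : IsVectorBundle T₁.X₂) (hK₂ : IsVectorBundle T₂.X₁)
    (hM₂ : IsVectorBundle T₂.X₂) {E V : X.left.Modules} (j : E ⟶ V) (p : V ⟶ T₁.X₃ ⊞ T₂.X₃) (w : j ≫ p = 0)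
    (hE : (ShortComplex.mk j p w).ShortExact) (hEvb : IsVectorBundle E) (hV : IsVectorBundle V) (i : ℕ) :
    C.ch X E i = C.ch X V i + (C.ch X T₁.X₁ i - C.ch X T₁.X₂ i) + (C.ch X T₂.X₁ i - C.ch X T₂.X₂ i) := by
  have h := ch_kernel_eq_of_presentation C (shortExact_biprod_map hT₁ hT₂)
    (isVectorBundle_biprod_of_isVectorBundle hK₁ hK₂) (isVectorBundle_biprod_of_isVectorBundle hM₁ hM₂) j p w hE
    hEvb hV i
  change C.ch X E i = C.ch X V i + C.ch X (T₁.X₁ ⊞ T₂.X₁) i - C.ch X (T₁.X₂ ⊞ T₂.X₂) i at h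
  rw [h, C.ch_biprod _ _ hK₁ hK₂, C.ch_biprod _ _ hM₁ hM₂]
  abel

/-! ### §4 Presentations by cokernels: the torsion piece as an object of `X.Modules` (no `i_*` needed) -/

/-- **A monomorphism of modules presents its cokernel**: for `s : K ⟶ M` mono, `0 → K → M → coker s → 0` is short exact.
So a torsion piece `i_*(M̃|_D)` of an elementary transformation is available as the object `cokernel s` of `X.Modules`
for the (injective) multiplication `s : M̃(−D) ⟶ M̃` by an equation of `D`, with its bundle presentation for free.
[cite: Fulton1998, Example 15.3.1] -/
theorem shortExact_of_mono_cokernel {K M : X.left.Modules} (s : K ⟶ M) [Mono s] :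
    (ShortComplex.mk s (cokernel.π s) (cokernel.condition s)).ShortExact :=
  ShortComplex.ShortExact.mk' (ShortComplex.exact_of_g_is_cokernel _ (cokernelIsCokernel s)) inferInstance
    inferInstance

/-- **Elementary transformation along a cokernel-presented piece**: for a monomorphism of vector bundles
`s : K ⟶ M` and a short exact `0 → E → V → coker s → 0` with `E`, `V` vector bundles,
`chᵢ(E) = chᵢ(V) + chᵢ(K) − chᵢ(M)` for every `C`. With `s = (· f_D) : M̃(−D) → M̃` this is
`ch(E) = ch(V) − ch(M̃)(1 − e^{−[D]})`, the printed formula for `ker(V ↠ i_*(M̃|_D))`.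
[cite: Fulton1998, §15.1 and Example 15.3.1] -/
theorem ch_kernel_eq_of_cokernel_presentation {K M : X.left.Modules} (s : K ⟶ M) [Mono s] (hK : IsVectorBundle K)
    (hM : IsVectorBundle M) {E V : X.left.Modules} (j : E ⟶ V) (p : V ⟶ cokernel s) (w : j ≫ p = 0)
    (hE : (ShortComplex.mk j p w).ShortExact) (hEvb : IsVectorBundle E) (hV : IsVectorBundle V) (i : ℕ) :
    C.ch X E i = C.ch X V i + C.ch X K i - C.ch X M i :=
  ch_kernel_eq_of_presentation C (shortExact_of_mono_cokernel s) hK hM j p w hE hEvb hV i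

/-- **Local freeness of elementary transformations is automatic** (hodge-idea-1's principle (L1) «`i_*F` has
projective dimension 1, so the kernel of any surjection from a locally free sheaf onto it is locally free (Schanuel)»,
here WITHOUT homological dimension): if `Q` has a bundle presentation `0 → K → M → Q → 0` and `p : V ⟶ Q` is an
epimorphism from a vector bundle, then `kernel p` is a vector bundle. Proof: `0 → kernel p → M ×_Q V → M → 0` is short
exact (`shortExact_kernel_pullback` for the presentation `(kernel.ι p, p)` and the map `M → Q`), its middle term is a
vector bundle (`isVectorBundle_kernelPullback` through `pullbackSymmetry`), so `kernel p` is the kernel of an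
epimorphism between vector bundles — finite locally free by Stacks 05P2 (tree `isVectorBundle_kernel`).
[cite: StacksProject, Tag 05P2] -/
theorem isVectorBundle_kernel_of_presentation {T : ShortComplex X.left.Modules} (hT : T.ShortExact)
    (hK : IsVectorBundle T.X₁) (hM : IsVectorBundle T.X₂) {V : X.left.Modules} (p : V ⟶ T.X₃) [Epi p]
    (hV : IsVectorBundle V) : IsVectorBundle (kernel p) := by
  -- `0 → kernel p → pullback T.g p → M → 0` is `shortExact_kernel_pullback` for the presentation `(kernel.ι p, p)`
  have hE : (ShortComplex.mk (kernel.ι p) p (kernel.condition p)).ShortExact :=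
    ShortComplex.ShortExact.mk' (ShortComplex.exact_of_f_is_kernel _ (kernelIsKernel p)) inferInstance
      inferInstance
  have h₁ := shortExact_kernel_pullback hE T.g
  -- the middle term `pullback T.g p` is a vector bundle: it is also the middle of `0 → K → V ×_Q M → V → 0` up to
  -- `pullbackSymmetry`, whose outer terms are bundles
  have hP : IsVectorBundle (pullback T.g p) :=
    (isVectorBundle_kernelPullback hT p hK hV).of_iso (pullbackSymmetry p T.g)
  haveI : Epi (pullback.fst T.g p) := h₁.epi_g
  -- `kernel p` is the kernel of the epimorphism `pullback.fst T.g p : M ×_Q V ⟶ M` between vector bundles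
  have hiso : kernel (pullback.fst T.g p) ≅ kernel p :=
    IsLimit.conePointUniqueUpToIso (kernelIsKernel (pullback.fst T.g p)) h₁.fIsKernel
  exact (Literature.AlgebraicGeometry.Modules.isVectorBundle_kernel (pullback.fst T.g p) hP hM).of_iso hiso

end Chern

end Summit.HodgeConjecture.HodgeConjecture.Theorems

end
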